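import Mathlib
import Literature.Computability.AlgebraicComplexity.MatrixMultiplicationExponent
import Literature.Computability.AlgebraicComplexity.AsymptoticRankZariskiClosedProofs
import Literature.Computability.AlgebraicComplexity.AlderStrassen

/-!
# `FidelityWitnesses.LinearDefectLaw`, line `border-singular-values`: `stub_passage`

Support file for crux item `stmt-MatrixMultiplication-14039`
(`Summit.MatrixMultiplication.MatrixMultiplication.Theses.FidelityWitnesses.LinearDefectLaw`), line
`border-singular-values` (reshape r1), registered stub `stub_passage` — the COMPACTNESS PASSAGE from
the residual spectral law at EXACT fidelity maximisers of the closed cone `closure {rank ≤ r}` to its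
`δ`-optimal honest form.

Notation (a fixed tensor `T : ι → ι → ι → ℂ`; for the stub `ι = Fin n × Fin n`, `T = ⟨n,n,n⟩`):
`ov S := Σ S · T`, `ns S := Σ ‖S abc‖²`, `fid S := |ov S|² / ns S`, and the residual evaluation
`G x y z S := Σ (T − (conj (ov S) / ns S) • S) abc · x a · y b · z c` (`T` minus its orthogonal
projection onto `ℂ · S`, evaluated on a triad).  To keep the file definition-free, `ov`, `ns`, `G`
enter the lemmas as function arguments pinned by their defining equations (`hov`, `hns`, `hG`);
the stub instantiates them by `rfl`.

* `stub_passage` — if every nonzero `S` of the closed cone at optimal scale (`ov S = ns S`) that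
  maximises `fid` against all honest rank-`≤ r` tensors admits unit `x, y, z` with
  `|Σ (T − S) x y z| ≥ 1` (hypothesis RSL), then for every `ε > 0` there is `δ > 0` such that every
  honest nonzero `δ`-optimal rank-`≤ r` tensor `S` admits unit `x, y, z` with `|G x y z S|² ≥ 1 − ε`.

Proof (`passage`, compactness + continuity).  Suppose not: get `ε > 0` and honest nonzero `S_k` of
rank `≤ r`, `1/(k+1)`-optimal, with `|G x y z S_k|² < 1 − ε` for all unit triads.  SCALE INVARIANCE
(`fid_smul`, `G_smul`, `tensorRank_smul_le`): normalise to `ns S_k = 1`.  COMPACTNESS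
(`isCompact_sphere_inter_closure`): the `ns`-sphere meets the closed cone in a compact set, so a
subsequence converges to `S∞` with `ns S∞ = 1`, `S∞` in the closed cone.  `fid` is continuous at
`S∞`, so `S∞` maximises `fid` against honest tensors (`ge_of_tendsto'`); `(conj (ov S∞)) • S∞` is
in the closed cone (`map_mem_closure`), at optimal scale, maximising, and nonzero because
`fid S∞ ≥ fid E > 0` for an honest `E` with `ov E ≠ 0` (for `⟨n,n,n⟩`: the unit product
`e ⊗ e ⊗ e`, `exists_unit_product`; `n, r ≥ 1` as a nonzero honest tensor exists).  RSL gives a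
unit triad with `|G x y z S∞| ≥ 1`; continuity of `G x y z` at `S∞` (`continuousAt_G`) contradicts
`|G x y z S_{φ k}|² < 1 − ε`.  Mathlib only, plus the tree facts `tensorRank_smul_le`,
`tensorRank_le_of_eq_sum`, `exists_eq_sum_triad_of_tensorRank_le`.
-/

set_option linter.dupNamespace false

namespace Summit.MatrixMultiplication.MatrixMultiplication.Theorems.LinearDefectLaw.Passage

open scoped BigOperators ComplexConjugate
open Literature.Computability.AlgebraicComplexity Filter Topology

section General

variable {ι : Type} [Fintype ι] {T : ι → ι → ι → ℂ} {ov : (ι → ι → ι → ℂ) → ℂ}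
  {ns : (ι → ι → ι → ℂ) → ℝ} {G : (ι → ℂ) → (ι → ℂ) → (ι → ℂ) → (ι → ι → ι → ℂ) → ℂ}

/-! ## Algebra: scale invariance -/

/-- `ov` is homogeneous: `ov (c • S) = c · ov S`. -/
theorem ov_smul (hov : ∀ S, ov S = ∑ a, ∑ b, ∑ c, S a b c * T a b c) (c : ℂ) (S : ι → ι → ι → ℂ) :
    ov (c • S) = c * ov S := by
  rw [hov, hov]
  simp only [Pi.smul_apply, smul_eq_mul, Finset.mul_sum]
  exact Finset.sum_congr rfl fun a _ => Finset.sum_congr rfl fun b _ =>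
    Finset.sum_congr rfl fun c _ => by ring

/-- `ns` is `2`-homogeneous: `ns (c • S) = ‖c‖² · ns S`. -/
theorem ns_smul (hns : ∀ S, ns S = ∑ a, ∑ b, ∑ c, ‖S a b c‖ ^ 2) (c : ℂ) (S : ι → ι → ι → ℂ) :
    ns (c • S) = ‖c‖ ^ 2 * ns S := by
  rw [hns, hns]
  simp only [Pi.smul_apply, smul_eq_mul, Finset.mul_sum, norm_mul, mul_pow]

/-- `ov 0 = 0`. -/
theorem ov_zero (hov : ∀ S, ov S = ∑ a, ∑ b, ∑ c, S a b c * T a b c) : ov 0 = 0 := by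
  rw [hov]
  simp

/-- `ns 0 = 0`. -/
theorem ns_zero (hns : ∀ S, ns S = ∑ a, ∑ b, ∑ c, ‖S a b c‖ ^ 2) : ns 0 = 0 := by
  rw [hns]
  simp

/-- Every entry is bounded by the Frobenius norm: `‖S abc‖² ≤ ns S`. -/
theorem norm_sq_le_ns (hns : ∀ S, ns S = ∑ a, ∑ b, ∑ c, ‖S a b c‖ ^ 2) (S : ι → ι → ι → ℂ)
    (a b c : ι) : ‖S a b c‖ ^ 2 ≤ ns S := by
  rw [hns]
  calc ‖S a b c‖ ^ 2 ≤ ∑ c', ‖S a b c'‖ ^ 2 :=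
        Finset.single_le_sum (f := fun c' => ‖S a b c'‖ ^ 2) (fun _ _ => by positivity)
          (Finset.mem_univ c)
    _ ≤ ∑ b', ∑ c', ‖S a b' c'‖ ^ 2 :=
        Finset.single_le_sum (f := fun b' => ∑ c', ‖S a b' c'‖ ^ 2)
          (fun _ _ => Finset.sum_nonneg fun _ _ => by positivity) (Finset.mem_univ b)
    _ ≤ ∑ a', ∑ b', ∑ c', ‖S a' b' c'‖ ^ 2 :=
        Finset.single_le_sum (f := fun a' => ∑ b', ∑ c', ‖S a' b' c'‖ ^ 2)
          (fun _ _ => Finset.sum_nonneg fun _ _ => Finset.sum_nonneg fun _ _ => by positivity)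
          (Finset.mem_univ a)

/-- A nonzero tensor has `ns S > 0`. -/
theorem ns_pos (hns : ∀ S, ns S = ∑ a, ∑ b, ∑ c, ‖S a b c‖ ^ 2) (S : ι → ι → ι → ℂ) (hS : S ≠ 0) :
    0 < ns S := by
  have h0 : 0 ≤ ns S := hns S ▸ Finset.sum_nonneg fun _ _ => Finset.sum_nonneg fun _ _ =>
    Finset.sum_nonneg fun _ _ => by positivity
  rcases h0.eq_or_lt with h | h
  · exfalso
    apply hS
    funext a b c
    have hle : ‖S a b c‖ ^ 2 ≤ 0 := h ▸ norm_sq_le_ns hns S a b c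
    have h00 : ‖S a b c‖ ^ 2 = 0 := le_antisymm hle (by positivity)
    exact norm_eq_zero.1 ((pow_eq_zero_iff two_ne_zero).1 h00)
  · exact h

/-- On the `ns`-unit sphere the sup norm is at most `1`. -/
theorem norm_le_one_of_ns_eq_one (hns : ∀ S, ns S = ∑ a, ∑ b, ∑ c, ‖S a b c‖ ^ 2)
    (S : ι → ι → ι → ℂ) (h : ns S = 1) : ‖S‖ ≤ 1 := by
  refine (pi_norm_le_iff_of_nonneg zero_le_one).2 fun a =>
    (pi_norm_le_iff_of_nonneg zero_le_one).2 fun b =>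
      (pi_norm_le_iff_of_nonneg zero_le_one).2 fun c => ?_
  exact (sq_le_one_iff₀ (norm_nonneg _)).1 (h ▸ norm_sq_le_ns hns S a b c)

/-- The projection coefficient is scale invariant:
`conj (c w) / (‖c‖² ν) · (c s) = conj w / ν · s` for `c ≠ 0`. -/
theorem proj_coeff_smul (c w s : ℂ) (ν : ℝ) (hc : c ≠ 0) :
    conj (c * w) / ((‖c‖ ^ 2 * ν : ℝ) : ℂ) * (c * s) = conj w / ((ν : ℝ) : ℂ) * s := by
  have h2 : ((‖c‖ ^ 2 : ℝ) : ℂ) = conj c * c := by rw [Complex.conj_mul', Complex.ofReal_pow]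
  have hc2 : ((‖c‖ ^ 2 : ℝ) : ℂ) ≠ 0 :=
    Complex.ofReal_ne_zero.2 (pow_ne_zero 2 (norm_ne_zero_iff.2 hc))
  calc conj (c * w) / ((‖c‖ ^ 2 * ν : ℝ) : ℂ) * (c * s)
      = conj c * c * (conj w * s) / (((‖c‖ ^ 2 : ℝ) : ℂ) * ((ν : ℝ) : ℂ)) := by
        rw [map_mul, Complex.ofReal_mul]
        ring
    _ = ((‖c‖ ^ 2 : ℝ) : ℂ) * (conj w * s) / (((‖c‖ ^ 2 : ℝ) : ℂ) * ((ν : ℝ) : ℂ)) := by rw [h2]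
    _ = conj w * s / ((ν : ℝ) : ℂ) := mul_div_mul_left _ _ hc2
    _ = conj w / ((ν : ℝ) : ℂ) * s := by ring

/-- Fidelity is scale invariant: `fid (c • S) = fid S` for `c ≠ 0`. -/
theorem fid_smul (hov : ∀ S, ov S = ∑ a, ∑ b, ∑ c, S a b c * T a b c)
    (hns : ∀ S, ns S = ∑ a, ∑ b, ∑ c, ‖S a b c‖ ^ 2) (c : ℂ) (hc : c ≠ 0) (S : ι → ι → ι → ℂ) :
    ‖ov (c • S)‖ ^ 2 / ns (c • S) = ‖ov S‖ ^ 2 / ns S := by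
  rw [ov_smul hov, ns_smul hns, norm_mul, mul_pow]
  exact mul_div_mul_left _ _ (pow_ne_zero 2 (norm_ne_zero_iff.2 hc))

/-- The residual evaluation is scale invariant: `G x y z (c • S) = G x y z S` for `c ≠ 0`. -/
theorem G_smul (hov : ∀ S, ov S = ∑ a, ∑ b, ∑ c, S a b c * T a b c)
    (hns : ∀ S, ns S = ∑ a, ∑ b, ∑ c, ‖S a b c‖ ^ 2)
    (hG : ∀ x y z S, G x y z S =
      ∑ a, ∑ b, ∑ c, (T a b c - conj (ov S) / ((ns S : ℝ) : ℂ) * S a b c) * x a * y b * z c)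
    (c : ℂ) (hc : c ≠ 0) (S : ι → ι → ι → ℂ) (x y z : ι → ℂ) :
    G x y z (c • S) = G x y z S := by
  rw [hG, hG, ov_smul hov, ns_smul hns]
  refine Finset.sum_congr rfl fun a _ => Finset.sum_congr rfl fun b _ =>
    Finset.sum_congr rfl fun c' _ => ?_
  rw [Pi.smul_apply, Pi.smul_apply, Pi.smul_apply, smul_eq_mul,
    proj_coeff_smul c (ov S) (S a b c') (ns S) hc]

/-! ## Topology: continuity and compactness -/

/-- `ov` is continuous. -/
theorem continuous_ov (hov : ∀ S, ov S = ∑ a, ∑ b, ∑ c, S a b c * T a b c) : Continuous ov := by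
  rw [show ov = fun S => ∑ a, ∑ b, ∑ c, S a b c * T a b c from funext hov]
  fun_prop

/-- `ns` is continuous. -/
theorem continuous_ns (hns : ∀ S, ns S = ∑ a, ∑ b, ∑ c, ‖S a b c‖ ^ 2) : Continuous ns := by
  rw [show ns = fun S => ∑ a, ∑ b, ∑ c, ‖S a b c‖ ^ 2 from funext hns]
  fun_prop

/-- The residual evaluation `S ↦ G x y z S = T(x,y,z) − (conj (ov S) / ns S) · S(x,y,z)` is
continuous at every `S₀` with `ns S₀ ≠ 0`. -/
theorem continuousAt_G (hov : ∀ S, ov S = ∑ a, ∑ b, ∑ c, S a b c * T a b c)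
    (hns : ∀ S, ns S = ∑ a, ∑ b, ∑ c, ‖S a b c‖ ^ 2)
    (hG : ∀ x y z S, G x y z S =
      ∑ a, ∑ b, ∑ c, (T a b c - conj (ov S) / ((ns S : ℝ) : ℂ) * S a b c) * x a * y b * z c)
    (x y z : ι → ℂ) {S₀ : ι → ι → ι → ℂ} (h : ns S₀ ≠ 0) : ContinuousAt (G x y z) S₀ := by
  have hGeq : G x y z = fun S => (∑ a, ∑ b, ∑ c, T a b c * x a * y b * z c) -
      conj (ov S) / ((ns S : ℝ) : ℂ) * ∑ a, ∑ b, ∑ c, S a b c * x a * y b * z c := by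
    funext S
    rw [hG]
    simp only [sub_mul, Finset.sum_sub_distrib, Finset.mul_sum, mul_assoc]
  rw [hGeq]
  have h' : ((ns S₀ : ℝ) : ℂ) ≠ 0 := Complex.ofReal_ne_zero.2 h
  have hB : Continuous fun S : ι → ι → ι → ℂ => ∑ a, ∑ b, ∑ c, S a b c * x a * y b * z c := by
    fun_prop
  have hq : ContinuousAt (fun S : ι → ι → ι → ℂ => conj (ov S) / ((ns S : ℝ) : ℂ)) S₀ :=
    (Complex.continuous_conj.comp (continuous_ov hov)).continuousAt.div₀
      (Complex.continuous_ofReal.comp (continuous_ns hns)).continuousAt h'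
  exact continuousAt_const.sub (hq.mul hB.continuousAt)

/-- The `ns`-unit sphere meets the closed cone `closure {rank ≤ r}` in a compact set (closed and
bounded in the finite-dimensional sup-normed space of tensors). -/
theorem isCompact_sphere_inter_closure (hns : ∀ S, ns S = ∑ a, ∑ b, ∑ c, ‖S a b c‖ ^ 2) (r : ℕ) :
    IsCompact ({S : ι → ι → ι → ℂ | ns S = 1} ∩
      closure {S' : ι → ι → ι → ℂ | tensorRank S' ≤ r}) := by
  refine Metric.isCompact_of_isClosed_isBounded
    ((isClosed_eq (continuous_ns hns) continuous_const).inter isClosed_closure) ?_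
  refine (Metric.isBounded_closedBall (x := (0 : ι → ι → ι → ℂ)) (r := 1)).subset fun S hS => ?_
  rw [mem_closedBall_zero_iff]
  exact norm_le_one_of_ns_eq_one hns S hS.1

/-- Scalar multiples stay in the closed cone `closure {rank ≤ r}`. -/
theorem smul_mem_closure_rank (r : ℕ) (c : ℂ) {S : ι → ι → ι → ℂ}
    (hS : S ∈ closure {S' : ι → ι → ι → ℂ | tensorRank S' ≤ r}) :
    c • S ∈ closure {S' : ι → ι → ι → ℂ | tensorRank S' ≤ r} :=
  map_mem_closure (continuous_const_smul c) hS fun S' hS' => (tensorRank_smul_le c S').trans hS'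

/-! ## The passage -/

/-- **Compactness passage** (vocabulary form of `stub_passage`, any fixed tensor `T`): if some
honest tensor has nonzero overlap whenever a nonzero honest tensor exists, then RSL at exact
maximisers of the closed cone implies the `δ`-optimal honest residual law. -/
theorem passage (hov : ∀ S, ov S = ∑ a, ∑ b, ∑ c, S a b c * T a b c)
    (hns : ∀ S, ns S = ∑ a, ∑ b, ∑ c, ‖S a b c‖ ^ 2)
    (hG : ∀ x y z S, G x y z S =
      ∑ a, ∑ b, ∑ c, (T a b c - conj (ov S) / ((ns S : ℝ) : ℂ) * S a b c) * x a * y b * z c)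
    (r : ℕ) (hE : ∀ S : ι → ι → ι → ℂ, S ≠ 0 → tensorRank S ≤ r →
      ∃ E : ι → ι → ι → ℂ, tensorRank E ≤ r ∧ ov E ≠ 0)
    (hRSL : ∀ S : ι → ι → ι → ℂ, S ∈ closure {S' : ι → ι → ι → ℂ | tensorRank S' ≤ r} → S ≠ 0 →
      ov S = ((ns S : ℝ) : ℂ) →
      (∀ S' : ι → ι → ι → ℂ, tensorRank S' ≤ r → ‖ov S'‖ ^ 2 ≤ ns S * ns S') →
      ∃ x y z : ι → ℂ, (∑ i, ‖x i‖ ^ 2) = 1 ∧ (∑ i, ‖y i‖ ^ 2) = 1 ∧ (∑ i, ‖z i‖ ^ 2) = 1 ∧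
        1 ≤ ‖∑ a, ∑ b, ∑ c, (T a b c - S a b c) * x a * y b * z c‖)
    (ε : ℝ) (hε : 0 < ε) :
    ∃ δ : ℝ, 0 < δ ∧ ∀ S : ι → ι → ι → ℂ, tensorRank S ≤ r → S ≠ 0 →
      (∀ S' : ι → ι → ι → ℂ, tensorRank S' ≤ r →
        ‖ov S'‖ ^ 2 / ns S' ≤ ‖ov S‖ ^ 2 / ns S + δ) →
      ∃ x y z : ι → ℂ, (∑ i, ‖x i‖ ^ 2) = 1 ∧ (∑ i, ‖y i‖ ^ 2) = 1 ∧ (∑ i, ‖z i‖ ^ 2) = 1 ∧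
        1 - ε ≤ ‖G x y z S‖ ^ 2 := by
  by_contra hcon
  push Not at hcon
  -- a violating sequence of honest nonzero `1/(k+1)`-optimal tensors
  have hseq : ∀ k : ℕ, ∃ S : ι → ι → ι → ℂ, tensorRank S ≤ r ∧ S ≠ 0 ∧
      (∀ S' : ι → ι → ι → ℂ, tensorRank S' ≤ r →
        ‖ov S'‖ ^ 2 / ns S' ≤ ‖ov S‖ ^ 2 / ns S + 1 / ((k : ℝ) + 1)) ∧
      ∀ x y z : ι → ℂ, (∑ i, ‖x i‖ ^ 2) = 1 → (∑ i, ‖y i‖ ^ 2) = 1 →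
        (∑ i, ‖z i‖ ^ 2) = 1 → ‖G x y z S‖ ^ 2 < 1 - ε :=
    fun k => hcon _ (by positivity)
  choose S₀ hrank₀ hne₀ hopt₀ hbad₀ using hseq
  -- (a) normalise to the `ns`-unit sphere
  have hns₀ : ∀ k, 0 < ns (S₀ k) := fun k => ns_pos hns _ (hne₀ k)
  obtain ⟨c, hc_ne, hc_norm⟩ : ∃ c : ℕ → ℂ, (∀ k, c k ≠ 0) ∧ ∀ k, ‖c k‖ ^ 2 * ns (S₀ k) = 1 := by
    refine ⟨fun k => (((Real.sqrt (ns (S₀ k)))⁻¹ : ℝ) : ℂ), fun k => ?_, fun k => ?_⟩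
    · exact Complex.ofReal_ne_zero.2 (inv_ne_zero (Real.sqrt_pos.2 (hns₀ k)).ne')
    · rw [Complex.norm_real, Real.norm_of_nonneg (inv_nonneg.2 (Real.sqrt_nonneg _)), inv_pow,
        Real.sq_sqrt (hns₀ k).le, inv_mul_cancel₀ (hns₀ k).ne']
  obtain ⟨S₁, hrank₁, hns₁, hopt₁, hbad₁⟩ : ∃ S₁ : ℕ → ι → ι → ι → ℂ,
      (∀ k, tensorRank (S₁ k) ≤ r) ∧ (∀ k, ns (S₁ k) = 1) ∧
      (∀ k (S' : ι → ι → ι → ℂ), tensorRank S' ≤ r →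
        ‖ov S'‖ ^ 2 / ns S' ≤ ‖ov (S₁ k)‖ ^ 2 / ns (S₁ k) + 1 / ((k : ℝ) + 1)) ∧
      ∀ k (x y z : ι → ℂ), (∑ i, ‖x i‖ ^ 2) = 1 → (∑ i, ‖y i‖ ^ 2) = 1 →
        (∑ i, ‖z i‖ ^ 2) = 1 → ‖G x y z (S₁ k)‖ ^ 2 < 1 - ε := by
    refine ⟨fun k => c k • S₀ k, fun k => (tensorRank_smul_le _ _).trans (hrank₀ k), fun k => ?_,
      fun k S' hS' => ?_, fun k x y z hx hy hz => ?_⟩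
    · show ns (c k • S₀ k) = 1
      rw [ns_smul hns, hc_norm]
    · show _ ≤ ‖ov (c k • S₀ k)‖ ^ 2 / ns (c k • S₀ k) + _
      rw [fid_smul hov hns _ (hc_ne k)]
      exact hopt₀ k S' hS'
    · show ‖G x y z (c k • S₀ k)‖ ^ 2 < 1 - ε
      rw [G_smul hov hns hG _ (hc_ne k)]
      exact hbad₀ k x y z hx hy hz
  -- (b) compactness: a convergent subsequence on the sphere ∩ closed cone
  obtain ⟨Sinf, ⟨hnsinf, hmeminf⟩, φ, hφ, hlim⟩ :=
    (isCompact_sphere_inter_closure hns r).tendsto_subseq (x := S₁)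
      fun k => ⟨hns₁ k, subset_closure (hrank₁ k)⟩
  have hns' : ns Sinf = 1 := hnsinf
  -- (c) the limit maximises the fidelity against honest tensors
  have hfid_tend : Tendsto (fun k => ‖ov (S₁ (φ k))‖ ^ 2 / ns (S₁ (φ k))) atTop
      (𝓝 (‖ov Sinf‖ ^ 2 / ns Sinf)) := by
    have hca : ContinuousAt (fun S : ι → ι → ι → ℂ => ‖ov S‖ ^ 2 / ns S) Sinf :=
      (((continuous_ov hov).norm.pow 2).continuousAt).div₀ (continuous_ns hns).continuousAt
        (by rw [hns']; exact one_ne_zero)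
    exact hca.tendsto.comp hlim
  have hδ_tend : Tendsto (fun k => 1 / ((φ k : ℝ) + 1)) atTop (𝓝 0) :=
    tendsto_one_div_add_atTop_nhds_zero_nat.comp hφ.tendsto_atTop
  have hmax : ∀ S' : ι → ι → ι → ℂ, tensorRank S' ≤ r → ‖ov S'‖ ^ 2 / ns S' ≤ ‖ov Sinf‖ ^ 2 := by
    intro S' hS'
    have h := ge_of_tendsto' (hfid_tend.add hδ_tend) fun k => hopt₁ (φ k) S' hS'
    rwa [hns', div_one, add_zero] at h
  -- (d) the limit has nonzero overlap; rescale it to optimal scale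
  obtain ⟨E, hErank, hEov⟩ := hE (S₀ 0) (hne₀ 0) (hrank₀ 0)
  have hEne : E ≠ 0 := fun h => hEov (by rw [h, ov_zero hov])
  have hov_pos : 0 < ‖ov Sinf‖ ^ 2 :=
    lt_of_lt_of_le (div_pos (pow_pos (norm_pos_iff.2 hEov) 2) (ns_pos hns E hEne)) (hmax E hErank)
  have hov_star : ov ((conj (ov Sinf) / ((ns Sinf : ℝ) : ℂ)) • Sinf) = ((‖ov Sinf‖ ^ 2 : ℝ) : ℂ) := by
    rw [ov_smul hov, hns', Complex.ofReal_one, div_one, Complex.conj_mul', Complex.ofReal_pow]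
  have hns_star : ns ((conj (ov Sinf) / ((ns Sinf : ℝ) : ℂ)) • Sinf) = ‖ov Sinf‖ ^ 2 := by
    rw [ns_smul hns, hns', Complex.ofReal_one, div_one, Complex.norm_conj, mul_one]
  have hne_star : (conj (ov Sinf) / ((ns Sinf : ℝ) : ℂ)) • Sinf ≠ 0 := by
    intro h
    have h0 : ns ((conj (ov Sinf) / ((ns Sinf : ℝ) : ℂ)) • Sinf) = 0 := by rw [h, ns_zero hns]
    rw [hns_star] at h0
    exact hov_pos.ne' h0
  have hscale : ov ((conj (ov Sinf) / ((ns Sinf : ℝ) : ℂ)) • Sinf) =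
      ((ns ((conj (ov Sinf) / ((ns Sinf : ℝ) : ℂ)) • Sinf) : ℝ) : ℂ) := by
    rw [hov_star, hns_star]
  have hmax_star : ∀ S' : ι → ι → ι → ℂ, tensorRank S' ≤ r →
      ‖ov S'‖ ^ 2 ≤ ns ((conj (ov Sinf) / ((ns Sinf : ℝ) : ℂ)) • Sinf) * ns S' := by
    intro S' hS'
    rw [hns_star]
    rcases eq_or_ne S' 0 with h0 | h0
    · rw [h0, ov_zero hov, norm_zero, ns_zero hns, mul_zero, zero_pow two_ne_zero]
    · exact (div_le_iff₀ (ns_pos hns S' h0)).1 (hmax S' hS')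
  -- (e) RSL at the rescaled limit: `T − (conj (ov S∞) / ns S∞) • S∞` is the residual of `S∞`
  obtain ⟨x, y, z, hx, hy, hz, hge⟩ :=
    hRSL _ (smul_mem_closure_rank r _ hmeminf) hne_star hscale hmax_star
  have hge' : 1 ≤ ‖G x y z Sinf‖ := by
    rw [hG]
    simpa only [Pi.smul_apply, smul_eq_mul] using hge
  -- (f) continuity of the residual evaluation at the limit
  have hGtend : Tendsto (fun k => ‖G x y z (S₁ (φ k))‖ ^ 2) atTop (𝓝 (‖G x y z Sinf‖ ^ 2)) :=
    (((continuousAt_G hov hns hG x y z (by rw [hns']; exact one_ne_zero)).norm.pow 2).tendsto).comp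
      hlim
  have hlt : 1 - ε < ‖G x y z Sinf‖ ^ 2 := by
    nlinarith [hge', hε, norm_nonneg (G x y z Sinf)]
  obtain ⟨k, hk⟩ := (hGtend.eventually_const_lt hlt).exists
  exact absurd hk (not_lt.2 (hbad₁ (φ k) x y z hx hy hz).le)

end General

/-! ## The stub: `T = ⟨n,n,n⟩` -/

/-- For `n ≥ 1` the unit product `e ⊗ e ⊗ e`, `e = e_{(0,0)}`, has rank `≤ 1` and overlap `1` with
`⟨n,n,n⟩`. -/
theorem exists_unit_product {n : ℕ} (hn : 0 < n) :
    ∃ E : Fin n × Fin n → Fin n × Fin n → Fin n × Fin n → ℂ, tensorRank E ≤ 1 ∧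
      (∑ a, ∑ b, ∑ c, E a b c * matMulTensor ℂ n n n a b c) = 1 := by
  obtain ⟨i⟩ : Nonempty (Fin n) := ⟨⟨0, hn⟩⟩
  refine ⟨triad (Pi.single (i, i) 1) (Pi.single (i, i) 1) (Pi.single (i, i) 1),
    tensorRank_le_of_eq_sum (fun _ : Fin 1 => Pi.single (i, i) 1) (fun _ => Pi.single (i, i) 1)
      (fun _ => Pi.single (i, i) 1) (by simp), ?_⟩
  rw [Fintype.sum_eq_single (i, i) fun a ha => by simp [ha],
    Fintype.sum_eq_single (i, i) fun b hb => by simp [hb],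
    Fintype.sum_eq_single (i, i) fun c hc => by simp [hc]]
  simp [matMulTensor]

/-- stub `stub_passage` of line `border-singular-values` (reshape r1) for crux `LinearDefectLaw`
(stmt-MatrixMultiplication-14039): compactness passage — the residual spectral law at exact
fidelity maximisers of the closed cone implies its δ-optimal honest form. -/
theorem stub_passage :
    ∀ (n r : ℕ),
      (∀ S : Fin n × Fin n → Fin n × Fin n → Fin n × Fin n → ℂ,
        S ∈ closure {S' : Fin n × Fin n → Fin n × Fin n → Fin n × Fin n → ℂ | tensorRank S' ≤ r} → S ≠ 0 →
        (∑ a, ∑ b, ∑ c, S a b c * matMulTensor ℂ n n n a b c) = ((∑ a, ∑ b, ∑ c, ‖S a b c‖ ^ 2 : ℝ) : ℂ) →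
        (∀ S' : Fin n × Fin n → Fin n × Fin n → Fin n × Fin n → ℂ, tensorRank S' ≤ r →
          ‖∑ a, ∑ b, ∑ c, S' a b c * matMulTensor ℂ n n n a b c‖ ^ 2 ≤
            (∑ a, ∑ b, ∑ c, ‖S a b c‖ ^ 2) * ∑ a, ∑ b, ∑ c, ‖S' a b c‖ ^ 2) →
        ∃ x y z : Fin n × Fin n → ℂ, (∑ i, ‖x i‖ ^ 2) = 1 ∧ (∑ i, ‖y i‖ ^ 2) = 1 ∧ (∑ i, ‖z i‖ ^ 2) = 1 ∧
          1 ≤ ‖∑ a, ∑ b, ∑ c, (matMulTensor ℂ n n n a b c - S a b c) * x a * y b * z c‖) →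
      ∀ ε : ℝ, 0 < ε → ∃ δ : ℝ, 0 < δ ∧
        ∀ S : Fin n × Fin n → Fin n × Fin n → Fin n × Fin n → ℂ, tensorRank S ≤ r → S ≠ 0 →
          (∀ S' : Fin n × Fin n → Fin n × Fin n → Fin n × Fin n → ℂ, tensorRank S' ≤ r →
            ‖∑ a, ∑ b, ∑ c, S' a b c * matMulTensor ℂ n n n a b c‖ ^ 2 / (∑ a, ∑ b, ∑ c, ‖S' a b c‖ ^ 2) ≤
              ‖∑ a, ∑ b, ∑ c, S a b c * matMulTensor ℂ n n n a b c‖ ^ 2 / (∑ a, ∑ b, ∑ c, ‖S a b c‖ ^ 2)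
                + δ) →
          ∃ x y z : Fin n × Fin n → ℂ, (∑ i, ‖x i‖ ^ 2) = 1 ∧ (∑ i, ‖y i‖ ^ 2) = 1 ∧ (∑ i, ‖z i‖ ^ 2) = 1 ∧
            1 - ε ≤ ‖∑ a, ∑ b, ∑ c, (matMulTensor ℂ n n n a b c -
              (starRingEnd ℂ) (∑ a', ∑ b', ∑ c', S a' b' c' * matMulTensor ℂ n n n a' b' c') /
                ((∑ a', ∑ b', ∑ c', ‖S a' b' c'‖ ^ 2 : ℝ) : ℂ) * S a b c) * x a * y b * z c‖ ^ 2 := by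
  intro n r hRSL ε hε
  -- a nonzero honest tensor forces `n, r ≥ 1`, whence the unit product is honest with overlap `1`
  have hE : ∀ S : Fin n × Fin n → Fin n × Fin n → Fin n × Fin n → ℂ, S ≠ 0 → tensorRank S ≤ r →
      ∃ E : Fin n × Fin n → Fin n × Fin n → Fin n × Fin n → ℂ, tensorRank E ≤ r ∧
        (∑ a, ∑ b, ∑ c, E a b c * matMulTensor ℂ n n n a b c) ≠ 0 := by
    intro S hS hSr
    have hn : 0 < n := by
      rcases Nat.eq_zero_or_pos n with h0 | hpos
      · subst h0
        exact absurd (funext fun a => Fin.elim0 a.1) hS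
      · exact hpos
    have hr : 1 ≤ r := by
      by_contra hr0
      push Not at hr0
      have h0 : tensorRank S ≤ 0 := by omega
      obtain ⟨w, u, v, hwuv⟩ := exists_eq_sum_triad_of_tensorRank_le h0
      exact hS (by rw [hwuv]; simp)
    obtain ⟨E, hE1, hEov⟩ := exists_unit_product hn
    exact ⟨E, hE1.trans hr, by rw [hEov]; exact one_ne_zero⟩
  exact passage (T := matMulTensor ℂ n n n)
    (ov := fun S => ∑ a, ∑ b, ∑ c, S a b c * matMulTensor ℂ n n n a b c)
    (ns := fun S => ∑ a, ∑ b, ∑ c, ‖S a b c‖ ^ 2)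
    (G := fun x y z S => ∑ a, ∑ b, ∑ c, (matMulTensor ℂ n n n a b c -
      conj (∑ a', ∑ b', ∑ c', S a' b' c' * matMulTensor ℂ n n n a' b' c') /
        ((∑ a', ∑ b', ∑ c', ‖S a' b' c'‖ ^ 2 : ℝ) : ℂ) * S a b c) * x a * y b * z c)
    (fun _ => rfl) (fun _ => rfl) (fun _ _ _ _ => rfl) r hE hRSL ε hε

end Summit.MatrixMultiplication.MatrixMultiplication.Theorems.LinearDefectLaw.Passage
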